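import Literature.AlgebraicGeometry.DeterminantalHypersurfaces.ChanIltenPermanentProductRankOne
import HarnessLib

/-!
# Lampert–Moshkovitz 2025: the quadratic expansion of the `4 × 4` determinant (`prk(det₄) = 3`)
# and the slice rank of `det_n`

Topic `Literature/Computability/AlgebraicComplexity`.  Source: A. Lampert, G. Moshkovitz, *Slice rank and
partition rank of the determinant*, ITCS 2026 (LIPIcs), arXiv:2509.06294 [LampertMoshkovitz2025]; read as the
held text `paper:arxiv-2509.06294` (pages `p0003`, `p0005`–`p0008`).  Everything in this file is PROVED (no named
fact, no definition, no `sorry`).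

Verbatim (p0007 L76–L100): "**3.2 Partition rank upper bound.** Here we demonstrate that, unlike for slice rank,
the partition rank of the determinant is not always full. We do so by presenting a (perhaps surprising)
"quadratic" expansion of the determinant of `4 × 4` matrices, quite unlike the Laplace expansion.  For an
`n × n` matrix `A` and subsets `I, J ⊆ [n]`, we denote by `A_{I,J}` the `|I| × |J|` submatrix of `A` on the rows
indexed by `I` and the columns indexed by `J`.
**Theorem 3.** For any `4 × 4` matrix `A` over any field,
`det(A) = (Σ_J det A_{{1,2},J})(Σ_J det A_{{3,4},J}) − (Σ_J det A_{{1,3},J})(Σ_J det A_{{2,4},J})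
        + (Σ_J det A_{{1,4},J})(Σ_J det A_{{2,3},J})`,
where all summations are over `J ∈ ([4] choose 2)` (all choices of `2` out of the `4` columns).
**Corollary 4.** Over any field, `prk(det₄) = 3`."
(p0003 L13–L15) "**Theorem 1.** `sr(det_n) = n` for every `n ≥ 2`, and the only minimum slice rank expansions
are all "equivalent" to the Laplace expansion."  (p0005 Definition 1: "its slice rank, written `sr(f)`, is the
minimal `r` such that `f = Σ_{i=1}^r α_i g_i`, where `α_i` are linear forms and `g_i` are forms of degree
`d − 1`.")

## What is formalised

* `LampertMoshkovitz.theorem3` — **Theorem 3** as printed, over any commutative ring: the six-term column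
  sums `P_{ab} = Σ_{J} det A_{{a,b},J}` are passed as a function `P` pinned by the hypothesis `hP` (so the
  statement carries no new definition), and `det A = P₀₁ P₂₃ − P₀₂ P₁₃ + P₀₃ P₁₂` (rows indexed `0..3`).
  `LampertMoshkovitz.theorem3'` is the same with `P_{ab}` written `Σ_i Σ_j [i < j] det A_{{a,b},{i,j}}`.
  Proof: Leibniz expansion of both sides (`ring`), i.e. the paper's `4`-to-`2` identity of Levi-Civita symbols
  `ε_{ijkℓ} = ε_{ij} ε_{kℓ} − ε_{ik} ε_{jℓ} + ε_{iℓ} ε_{jk}` checked monomial by monomial.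
* `LampertMoshkovitz.corollary4_upper` — **Corollary 4, upper half `prk(det₄) ≤ 3`**, in the two-factor
  language of the tree's generic determinant `detPoly (Fin 4) R`: there are quadratic forms `p₀, p₁, p₂`,
  `q₀, q₁, q₂` (each a sum of `2 × 2` minors on a fixed pair of rows, hence bilinear in those two rows — a
  partition-rank decomposition for the row partition) with `det₄ = p₀ q₀ + p₁ q₁ + p₂ q₂`.  In particular the
  determinantal analogue of "every `(2,2)` two-factor decomposition of a `4 × 4` permanent/determinant has
  `≥ C(4,2) = 6` terms" is FALSE for the determinant (`3 < 6`); the lower half `prk(det₄) ≥ 3` (Theorem 2,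
  `prk(det_n) ≥ ⌊log₂ n⌋ + 1`) is not formalised here.
* `LampertMoshkovitz.theorem1_lower` / `theorem1_upper` — **Theorem 1, `sr(det_n) = n`** (first clause): no
  expansion `det_n = Σ_{i<w} ℓ_i q_i` with linear `ℓ_i` has `w < n` — over an INFINITE field, by name from the
  tree's Dieudonné/Chan–Ilten bound `ChanIlten.le_of_detPoly_eq_sum_linear_mul` (the paper proves it over every
  field via Meshulam's theorem, Proposition 1; `TODO(general form)`: finite fields) — and the Laplace expansion
  along row `0` attains `w = n` over any commutative ring (`Matrix.det_succ_row_zero`).  The uniqueness clause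
  ("equivalent to the Laplace expansion") is not formalised.

Honest framing: small exact calibration facts for rank-type laws on two-factor decompositions (the
`ValiantsHypothesis` line `laplace_rigidity` cites Theorem 3 as the reason such a law must be specific to the
permanent); nothing here bears on `VP ≠ VNP` (NOT proved), and no summit statement is proved in this file.

[cite: LampertMoshkovitz2025, Theorem 3, Corollary 4, Theorem 1]
-/

noncomputable section

namespace Literature.Computability.AlgebraicComplexity.LampertMoshkovitz

open Matrix MvPolynomial Finset

/-! ### Theorem 3: the quadratic expansion of `det₄` -/

section MatrixIdentity

variable {R : Type*} [CommRing R]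

/-- `Fin.succAbove 2 2 = 3` in `Fin 4` (index bookkeeping for `det_fin_four`). [folklore] -/
private theorem succAbove_two_two : Fin.succAbove (2 : Fin 4) (2 : Fin 3) = 3 := by decide
/-- `Fin.succAbove 3 2 = 2` in `Fin 4`. [folklore] -/
private theorem succAbove_three_two : Fin.succAbove (3 : Fin 4) (2 : Fin 3) = 2 := by decide
/-- `Fin.succAbove 1 2 = 3` in `Fin 4`. [folklore] -/
private theorem succAbove_one_two : Fin.succAbove (1 : Fin 4) (2 : Fin 3) = 3 := by decide

/-- Leibniz expansion of a `4 × 4` determinant (same bookkeeping as the tree's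
`KleinCorrespondence.det_fin_four`). [folklore] -/
private theorem det_fin_four (A : Matrix (Fin 4) (Fin 4) R) :
    A.det =
      A 0 0 * A 1 1 * A 2 2 * A 3 3 - A 0 0 * A 1 1 * A 2 3 * A 3 2
        - A 0 0 * A 1 2 * A 2 1 * A 3 3 + A 0 0 * A 1 2 * A 2 3 * A 3 1
        + A 0 0 * A 1 3 * A 2 1 * A 3 2 - A 0 0 * A 1 3 * A 2 2 * A 3 1
        - A 0 1 * A 1 0 * A 2 2 * A 3 3 + A 0 1 * A 1 0 * A 2 3 * A 3 2
        + A 0 1 * A 1 2 * A 2 0 * A 3 3 - A 0 1 * A 1 2 * A 2 3 * A 3 0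
        - A 0 1 * A 1 3 * A 2 0 * A 3 2 + A 0 1 * A 1 3 * A 2 2 * A 3 0
        + A 0 2 * A 1 0 * A 2 1 * A 3 3 - A 0 2 * A 1 0 * A 2 3 * A 3 1
        - A 0 2 * A 1 1 * A 2 0 * A 3 3 + A 0 2 * A 1 1 * A 2 3 * A 3 0
        + A 0 2 * A 1 3 * A 2 0 * A 3 1 - A 0 2 * A 1 3 * A 2 1 * A 3 0
        - A 0 3 * A 1 0 * A 2 1 * A 3 2 + A 0 3 * A 1 0 * A 2 2 * A 3 1
        + A 0 3 * A 1 1 * A 2 0 * A 3 2 - A 0 3 * A 1 1 * A 2 2 * A 3 0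
        - A 0 3 * A 1 2 * A 2 0 * A 3 1 + A 0 3 * A 1 2 * A 2 1 * A 3 0 := by
  rw [Matrix.det_succ_row_zero]
  simp [Fin.sum_univ_succ, Matrix.det_fin_three, succAbove_two_two, succAbove_three_two,
    succAbove_one_two]
  ring

/-- **Lampert–Moshkovitz, Theorem 3** (the quadratic expansion of the `4 × 4` determinant), over any
commutative ring: with `P a b = Σ_{J ∈ ([4] choose 2)} det A_{{a,b},J}` the sum of the six `2 × 2` minors on the
rows `a, b` (pinned by `hP`; rows and columns indexed by `Fin 4 = {0,1,2,3}`),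
`det A = P₀₁ · P₂₃ − P₀₂ · P₁₃ + P₀₃ · P₁₂`. [cite: LampertMoshkovitz2025, Theorem 3] -/
theorem theorem3 (A : Matrix (Fin 4) (Fin 4) R) (P : Fin 4 → Fin 4 → R)
    (hP : ∀ a b, P a b =
      (A.submatrix ![a, b] ![0, 1]).det + (A.submatrix ![a, b] ![0, 2]).det +
        (A.submatrix ![a, b] ![0, 3]).det + (A.submatrix ![a, b] ![1, 2]).det +
        (A.submatrix ![a, b] ![1, 3]).det + (A.submatrix ![a, b] ![2, 3]).det) :
    A.det = P 0 1 * P 2 3 - P 0 2 * P 1 3 + P 0 3 * P 1 2 := by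
  simp only [hP, Matrix.det_fin_two, Matrix.submatrix_apply, Matrix.cons_val_zero, Matrix.cons_val_one]
  rw [det_fin_four]
  ring

/-- The sum over `J ∈ ([4] choose 2)` written as `Σ_i Σ_j [i < j]`. [folklore] -/
private theorem sum_sum_ite_lt_fin_four (f : Fin 4 → Fin 4 → R) :
    (∑ i : Fin 4, ∑ j : Fin 4, if i < j then f i j else 0) =
      f 0 1 + f 0 2 + f 0 3 + f 1 2 + f 1 3 + f 2 3 := by
  simp only [Fin.sum_univ_four, Fin.isValue]
  have h01 : (0 : Fin 4) < 1 := by decide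
  have h02 : (0 : Fin 4) < 2 := by decide
  have h03 : (0 : Fin 4) < 3 := by decide
  have h12 : (1 : Fin 4) < 2 := by decide
  have h13 : (1 : Fin 4) < 3 := by decide
  have h23 : (2 : Fin 4) < 3 := by decide
  have n10 : ¬ (1 : Fin 4) < 0 := by decide
  have n20 : ¬ (2 : Fin 4) < 0 := by decide
  have n30 : ¬ (3 : Fin 4) < 0 := by decide
  have n21 : ¬ (2 : Fin 4) < 1 := by decide
  have n31 : ¬ (3 : Fin 4) < 1 := by decide
  have n32 : ¬ (3 : Fin 4) < 2 := by decide
  simp only [lt_irrefl, if_false, h01, h02, h03, h12, h13, h23, if_true, n10, n20, n30, n21, n31, n32]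
  ring

/-- **Theorem 3, summation form**: `det A = (Σ_{i<j} det A_{{0,1},{i,j}})(Σ_{i<j} det A_{{2,3},{i,j}})
− (Σ_{i<j} det A_{{0,2},{i,j}})(Σ_{i<j} det A_{{1,3},{i,j}}) + (Σ_{i<j} det A_{{0,3},{i,j}})(Σ_{i<j} det A_{{1,2},{i,j}})`
for every `4 × 4` matrix over a commutative ring. [cite: LampertMoshkovitz2025, Theorem 3] -/
theorem theorem3' (A : Matrix (Fin 4) (Fin 4) R) :
    A.det =
      (∑ i : Fin 4, ∑ j : Fin 4, if i < j then (A.submatrix ![0, 1] ![i, j]).det else 0) *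
          (∑ i : Fin 4, ∑ j : Fin 4, if i < j then (A.submatrix ![2, 3] ![i, j]).det else 0) -
        (∑ i : Fin 4, ∑ j : Fin 4, if i < j then (A.submatrix ![0, 2] ![i, j]).det else 0) *
          (∑ i : Fin 4, ∑ j : Fin 4, if i < j then (A.submatrix ![1, 3] ![i, j]).det else 0) +
        (∑ i : Fin 4, ∑ j : Fin 4, if i < j then (A.submatrix ![0, 3] ![i, j]).det else 0) *
          (∑ i : Fin 4, ∑ j : Fin 4, if i < j then (A.submatrix ![1, 2] ![i, j]).det else 0) := by
  simp only [sum_sum_ite_lt_fin_four]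
  exact theorem3 A (fun a b =>
      (A.submatrix ![a, b] ![0, 1]).det + (A.submatrix ![a, b] ![0, 2]).det +
        (A.submatrix ![a, b] ![0, 3]).det + (A.submatrix ![a, b] ![1, 2]).det +
        (A.submatrix ![a, b] ![1, 3]).det + (A.submatrix ![a, b] ![2, 3]).det) (fun _ _ => rfl)

/-- The example of the paper (p0008 L5–L13): for a diagonal matrix the expansion reads
`abcd = (ab)(cd) − (ac)(bd) + (ad)(bc)`. [cite: LampertMoshkovitz2025, §3.2 (example)] -/
theorem theorem3_diagonal_example (a b c d : R) :
    a * b * c * d = (a * b) * (c * d) - (a * c) * (b * d) + (a * d) * (b * c) := by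
  ring

end MatrixIdentity

/-! ### Corollary 4 (upper half): `det₄` is a sum of THREE products of quadratic forms -/

section PartitionRank

variable {R : Type*} [CommRing R]

/-- A `2 × 2` minor of the generic matrix is a quadratic form. [folklore] -/
private theorem isHomogeneous_minor_two (ρ γ : Fin 2 → Fin 4) :
    (((Matrix.mvPolynomialX (Fin 4) (Fin 4) R).submatrix ρ γ).det).IsHomogeneous 2 := by
  rw [Matrix.det_fin_two]
  simp only [Matrix.submatrix_apply, Matrix.mvPolynomialX_apply]
  exact ((isHomogeneous_X R _).mul (isHomogeneous_X R _)).sub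
    ((isHomogeneous_X R _).mul (isHomogeneous_X R _))

/-- **Lampert–Moshkovitz, Corollary 4 (upper half, `prk(det₄) ≤ 3`)** in the two-factor language of the
generic determinant `detPoly (Fin 4) R = det (X_{ij})`: over any commutative ring there are quadratic forms
`p₀, p₁, p₂, q₀, q₁, q₂` in the `16` variables with `det₄ = p₀ q₀ + p₁ q₁ + p₂ q₂` — namely
`p = (P₀₁, −P₀₂, P₀₃)`, `q = (P₂₃, P₁₃, P₁₂)` with `P_{ab}` the sum of the six `2 × 2` minors on rows `a, b`
(Theorem 3).  So a `(2,2)` two-factor decomposition of `det₄` can have `3 < 6 = C(4,2)` terms: the determinantal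
analogue of the generalised-Laplace lower bound fails.  (The matching lower bound `prk(det₄) ≥ 3`, Theorem 2,
is not formalised here.) [cite: LampertMoshkovitz2025, Corollary 4 (with Theorem 3)] -/
theorem corollary4_upper :
    ∃ p q : Fin 3 → MvPolynomial (Fin 4 × Fin 4) R,
      (∀ i, (p i).IsHomogeneous 2) ∧ (∀ i, (q i).IsHomogeneous 2) ∧
        detPoly (Fin 4) R = ∑ i, p i * q i := by
  -- the six-minor column sums of the generic matrix
  let Xm : Matrix (Fin 4) (Fin 4) (MvPolynomial (Fin 4 × Fin 4) R) := Matrix.mvPolynomialX (Fin 4) (Fin 4) R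
  let P : Fin 4 → Fin 4 → MvPolynomial (Fin 4 × Fin 4) R := fun a b =>
    (Xm.submatrix ![a, b] ![0, 1]).det + (Xm.submatrix ![a, b] ![0, 2]).det +
      (Xm.submatrix ![a, b] ![0, 3]).det + (Xm.submatrix ![a, b] ![1, 2]).det +
      (Xm.submatrix ![a, b] ![1, 3]).det + (Xm.submatrix ![a, b] ![2, 3]).det
  have hP : ∀ a b, (P a b).IsHomogeneous 2 := by
    intro a b
    exact (((((isHomogeneous_minor_two _ _).add (isHomogeneous_minor_two _ _)).add
      (isHomogeneous_minor_two _ _)).add (isHomogeneous_minor_two _ _)).add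
      (isHomogeneous_minor_two _ _)).add (isHomogeneous_minor_two _ _)
  refine ⟨![P 0 1, -P 0 2, P 0 3], ![P 2 3, P 1 3, P 1 2], ?_, ?_, ?_⟩
  · intro i
    fin_cases i
    · exact hP 0 1
    · exact (hP 0 2).neg
    · exact hP 0 3
  · intro i
    fin_cases i
    · exact hP 2 3
    · exact hP 1 3
    · exact hP 1 2
  · have h := theorem3 Xm P (fun _ _ => rfl)
    simp only [Fin.sum_univ_three, Matrix.cons_val_zero, Matrix.cons_val_one, Matrix.cons_val_two,
      Matrix.head_cons, Matrix.tail_cons]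
    unfold detPoly
    rw [h]
    ring

end PartitionRank

/-! ### Theorem 1 (first clause): the slice rank of `det_n` is `n` -/

section SliceRank

/-- **Lampert–Moshkovitz, Theorem 1, lower half (`sr(det_n) ≥ n`) over an infinite field**: if
`det_n = Σ_{i<w} ℓ_i q_i` with linear forms `ℓ_i` (and arbitrary `q_i`), then `n ≤ w`.  By name from the
tree's Dieudonné / Chan–Ilten bound `ChanIlten.le_of_detPoly_eq_sum_linear_mul` (a subspace of singular `n × n`
matrices has dimension `≤ n² − n`); the paper derives it over every field from Meshulam's theorem
(Proposition 1) — TODO(general form): finite fields. [cite: LampertMoshkovitz2025, Theorem 1] -/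
theorem theorem1_lower {K : Type*} [Field K] [Infinite K] {n w : ℕ}
    (ℓ q : Fin w → MvPolynomial (Fin n × Fin n) K) (hℓ : ∀ i, (ℓ i).IsHomogeneous 1)
    (h : detPoly (Fin n) K = ∑ i, ℓ i * q i) : n ≤ w :=
  Literature.AlgebraicGeometry.DeterminantalHypersurfaces.ChanIlten.le_of_detPoly_eq_sum_linear_mul ℓ q hℓ h

variable {R : Type*} [CommRing R]

/-- The determinant of a square matrix of variables is a form of degree the size. [folklore] -/
private theorem isHomogeneous_det_X_submatrix {n m : ℕ} (ρ γ : Fin m → Fin n) :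
    (((Matrix.mvPolynomialX (Fin n) (Fin n) R).submatrix ρ γ).det).IsHomogeneous m := by
  rw [Matrix.det_apply']
  refine IsHomogeneous.sum _ _ _ fun σ _ => ?_
  have hprod := IsHomogeneous.prod (Finset.univ : Finset (Fin m))
    (fun i => ((Matrix.mvPolynomialX (Fin n) (Fin n) R).submatrix ρ γ) (σ i) i) (fun _ => 1)
    fun i _ => by
      simp only [Matrix.submatrix_apply, Matrix.mvPolynomialX_apply]
      exact isHomogeneous_X R _
  have hsign : (((Equiv.Perm.sign σ : ℤ) : MvPolynomial (Fin n × Fin n) R)).IsHomogeneous 0 := by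
    rw [← map_intCast (C : R →+* MvPolynomial (Fin n × Fin n) R)]
    exact isHomogeneous_C _ _
  simpa using hsign.mul hprod

/-- **Lampert–Moshkovitz, Theorem 1, upper half (`sr(det_n) ≤ n`)**: the Laplace expansion along row `0`
(`Matrix.det_succ_row_zero`) writes `det_{n+1} = Σ_{j ≤ n} X_{0j} · (± det of the minor (0,j))`, a sum of
`n + 1` products (linear form) × (form of degree `n`), over any commutative ring.
[cite: LampertMoshkovitz2025, Theorem 1 (Laplace expansion)] -/
theorem theorem1_upper (n : ℕ) :
    ∃ ℓ q : Fin (n + 1) → MvPolynomial (Fin (n + 1) × Fin (n + 1)) R,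
      (∀ j, (ℓ j).IsHomogeneous 1) ∧ (∀ j, (q j).IsHomogeneous n) ∧
        detPoly (Fin (n + 1)) R = ∑ j, ℓ j * q j := by
  refine ⟨fun j => X ((0 : Fin (n + 1)), j),
    fun j => (-1) ^ (j : ℕ) * ((Matrix.mvPolynomialX (Fin (n + 1)) (Fin (n + 1)) R).submatrix
      Fin.succ j.succAbove).det,
    fun j => isHomogeneous_X _ _, fun j => ?_, ?_⟩
  · have h1 : ((-1 : MvPolynomial (Fin (n + 1) × Fin (n + 1)) R) ^ (j : ℕ)).IsHomogeneous 0 := by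
      simpa using ((isHomogeneous_one (Fin (n + 1) × Fin (n + 1)) R).neg).pow (j : ℕ)
    simpa using h1.mul (isHomogeneous_det_X_submatrix Fin.succ j.succAbove)
  · unfold detPoly
    rw [Matrix.det_succ_row_zero]
    refine Finset.sum_congr rfl fun j _ => ?_
    simp only [Matrix.mvPolynomialX_apply]
    ring

end SliceRank

end Literature.Computability.AlgebraicComplexity.LampertMoshkovitz

end
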